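import Mathlib.LinearAlgebra.Matrix.PosDef
import Mathlib.Analysis.SpecialFunctions.Pow.Real
import HarnessLib

/-!
# Pointwise algebra of the Krylov–Safonov barrier (Gilbarg–Trudinger, proof of Thm. 9.22, p. 247)

The weak Harnack inequality is proved by applying the ABP estimate to `v = η w`,
`w = -log ū`, `η = (1 - |x|²)^β`. This file isolates the POINTWISE ALGEBRA of that computation,
with all calculus stripped away: at a point, the data are a coefficient matrix `a` with
`λ|ξ|² ≤ a ξ·ξ ≤ Λ|ξ|²`, the gradients `p = Dw`, `q = Dη` (coordinates in an orthonormal frame),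
the Hessian matrices `H_w, H_η, H_v`, and scalars `η > 0`, `w`, `g`.

* `two_mul_abs_bilin_le` — Schwarz: `2|qᵀap| ≤ η pᵀap + qᵀaq/η`;
* `neg_pair_hessian_log` — the log transform: `H_w = -H_ū/ū + p pᵀ`, `a:H_ū ≤ f` give
  `-a:H_w ≤ f/ū - pᵀap`;
* `neg_pair_hessian_product_le` — the product rule `H_v = η H_w + p qᵀ + q pᵀ + w H_η` then gives
  `-a:H_v ≤ η g + qᵀaq/η - w a:H_η` (GT's first display on p. 247 with `b = c = 0`);
* `eta_gradient_term_le`, `eta_hessian_pair_nonneg`, `neg_w_eta_hessian_le` — the three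
  estimates on the cutoff `η = (1-s)^β`, `s = |x|²` (GT's second and third displays);
* `barrier_rhs_le` — the final pointwise right-hand side
  `-a:H_v ≤ 4β²Λ + g⁺ + (2βnΛ/(1-α²)) v⁺ 𝟙_{s<α²}` on `{v > 0}`.

## References

* D. Gilbarg, N. S. Trudinger, *Elliptic Partial Differential Equations of Second Order* (2001),
  proof of Theorem 9.22, p. 247. [GilbargTrudinger2001]
-/

noncomputable section

open Matrix Finset

namespace Literature.Analysis.PDE.KrylovSafonov

variable {ι : Type*} [Fintype ι] [DecidableEq ι]

/-- The pairing `a : H = Σ_{ij} a_{ij} H_{ij}`. [folklore] -/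
def pair (a H : Matrix ι ι ℝ) : ℝ := ∑ i, ∑ j, a i j * H i j

omit [DecidableEq ι] in
/-- `pair` is additive in `H`. [folklore] -/
theorem pair_add (a H K : Matrix ι ι ℝ) : pair a (H + K) = pair a H + pair a K := by
  simp only [pair, Matrix.add_apply, mul_add, Finset.sum_add_distrib]

omit [DecidableEq ι] in
/-- `pair` is homogeneous in `H`. [folklore] -/
theorem pair_smul (a H : Matrix ι ι ℝ) (c : ℝ) : pair a (c • H) = c * pair a H := by
  simp only [pair, Matrix.smul_apply, smul_eq_mul, Finset.mul_sum]
  refine Finset.sum_congr rfl fun i _ ↦ Finset.sum_congr rfl fun j _ ↦ by ring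

omit [DecidableEq ι] in
/-- Pairing with a dyad: `Σ a_{ij} p_i q_j = p ⬝ (a q)`. [folklore] -/
theorem pair_vecMulVec (a : Matrix ι ι ℝ) (p q : ι → ℝ) :
    pair a (vecMulVec p q) = p ⬝ᵥ (a *ᵥ q) := by
  simp only [pair, vecMulVec_apply, dotProduct, mulVec, Finset.mul_sum]
  refine Finset.sum_congr rfl fun i _ ↦ Finset.sum_congr rfl fun j _ ↦ by ring

omit [DecidableEq ι] in
/-- For symmetric `a`, `p ⬝ (a q) = q ⬝ (a p)`. [folklore] -/
theorem dotProduct_mulVec_comm {a : Matrix ι ι ℝ} (ha : a.IsSymm) (p q : ι → ℝ) :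
    p ⬝ᵥ (a *ᵥ q) = q ⬝ᵥ (a *ᵥ p) := by
  have h : ∀ i j, a i j = a j i := fun i j ↦ by
    have := congrFun (congrFun ha j) i
    simpa [Matrix.transpose_apply] using this
  simp only [dotProduct, mulVec, Finset.mul_sum]
  rw [Finset.sum_comm]
  refine Finset.sum_congr rfl fun i _ ↦ Finset.sum_congr rfl fun j _ ↦ by rw [h j i]; ring

/-- Pairing with the identity is the trace. [folklore] -/
theorem pair_one (a : Matrix ι ι ℝ) : pair a 1 = a.trace := by
  simp only [pair, Matrix.one_apply, mul_ite, mul_one, mul_zero, Finset.sum_ite_eq,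
    Finset.mem_univ, if_true, Matrix.trace, Matrix.diag]

/-! ### Schwarz -/

omit [DecidableEq ι] in
/-- **Schwarz's inequality for the form `a ≥ 0`**: `2|q ⬝ a p| ≤ η (p ⬝ a p) + (q ⬝ a q)/η` for
`η > 0` (expand `0 ≤ (ηp ± q)ᵀ a (ηp ± q)`). [cite: GilbargTrudinger2001, proof of Thm 9.22
("using Schwarz's inequality")] -/
theorem two_mul_abs_bilin_le {a : Matrix ι ι ℝ} (ha : a.IsSymm)
    (hpsd : ∀ v : ι → ℝ, 0 ≤ v ⬝ᵥ (a *ᵥ v)) (p q : ι → ℝ) {η : ℝ} (hη : 0 < η) :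
    2 * |q ⬝ᵥ (a *ᵥ p)| ≤ η * (p ⬝ᵥ (a *ᵥ p)) + (q ⬝ᵥ (a *ᵥ q)) / η := by
  have expand : ∀ t : ℝ, ∀ σ : ℝ, (t • p + σ • q) ⬝ᵥ (a *ᵥ (t • p + σ • q)) =
      t ^ 2 * (p ⬝ᵥ (a *ᵥ p)) + 2 * t * σ * (q ⬝ᵥ (a *ᵥ p)) + σ ^ 2 * (q ⬝ᵥ (a *ᵥ q)) := by
    intro t σ
    have hc := dotProduct_mulVec_comm ha p q
    simp only [mulVec_add, mulVec_smul, dotProduct_add, add_dotProduct, dotProduct_smul,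
      smul_dotProduct, smul_eq_mul, hc]
    ring
  have h1 := hpsd (η • p + (1 : ℝ) • q)
  have h2 := hpsd (η • p + (-1 : ℝ) • q)
  rw [expand] at h1 h2
  have key1 : 2 * (q ⬝ᵥ (a *ᵥ p)) ≤ η * (p ⬝ᵥ (a *ᵥ p)) + q ⬝ᵥ (a *ᵥ q) / η := by
    rw [← sub_nonneg]
    have : η * (p ⬝ᵥ (a *ᵥ p)) + q ⬝ᵥ (a *ᵥ q) / η - 2 * (q ⬝ᵥ (a *ᵥ p)) =
        (η ^ 2 * (p ⬝ᵥ (a *ᵥ p)) + 2 * η * (-1) * (q ⬝ᵥ (a *ᵥ p)) +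
          (-1) ^ 2 * (q ⬝ᵥ (a *ᵥ q))) / η := by
      field_simp; ring
    rw [this]; exact div_nonneg h2 hη.le
  have key2 : -(2 * (q ⬝ᵥ (a *ᵥ p))) ≤ η * (p ⬝ᵥ (a *ᵥ p)) + q ⬝ᵥ (a *ᵥ q) / η := by
    rw [← sub_nonneg]
    have : η * (p ⬝ᵥ (a *ᵥ p)) + q ⬝ᵥ (a *ᵥ q) / η - -(2 * (q ⬝ᵥ (a *ᵥ p))) =
        (η ^ 2 * (p ⬝ᵥ (a *ᵥ p)) + 2 * η * 1 * (q ⬝ᵥ (a *ᵥ p)) +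
          1 ^ 2 * (q ⬝ᵥ (a *ᵥ q))) / η := by
      field_simp; ring
    rw [this]; exact div_nonneg h1 hη.le
  rw [show 2 * |q ⬝ᵥ (a *ᵥ p)| = |2 * (q ⬝ᵥ (a *ᵥ p))| by
    rw [abs_mul, abs_two], abs_le]
  exact ⟨by linarith, key1⟩

/-! ### The log transform and the product rule -/

omit [DecidableEq ι] in
/-- **Log transform**: if `H_w = -(1/ū) H_ū + p pᵀ` (the Hessian of `w = -log ū`, `p = Dw`) and
`a : H_ū ≤ f` with `ū > 0`, then `-a : H_w ≤ f/ū - p ⬝ a p`.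
[cite: GilbargTrudinger2001, proof of Thm 9.22, first display] -/
theorem neg_pair_hessian_log {a Hu Hw : Matrix ι ι ℝ} {p : ι → ℝ} {ubar f : ℝ} (hubar : 0 < ubar)
    (hHw : Hw = -(ubar⁻¹ • Hu) + vecMulVec p p) (hsuper : pair a Hu ≤ f) :
    -pair a Hw ≤ f / ubar - p ⬝ᵥ (a *ᵥ p) := by
  rw [hHw, pair_add, pair_vecMulVec]
  have : pair a (-(ubar⁻¹ • Hu)) = -(ubar⁻¹ * pair a Hu) := by
    rw [show -(ubar⁻¹ • Hu) = (-ubar⁻¹) • Hu by rw [neg_smul], pair_smul]; ring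
  rw [this]
  have h : ubar⁻¹ * pair a Hu ≤ f / ubar := by
    rw [div_eq_inv_mul]; exact mul_le_mul_of_nonneg_left hsuper (inv_nonneg.2 hubar.le)
  linarith

omit [DecidableEq ι] in
/-- **Product rule + Schwarz**: with `H_v = η H_w + p qᵀ + q pᵀ + w H_η` (`v = ηw`, `p = Dw`,
`q = Dη`), `a ≥ 0` symmetric, `η > 0` and `-a:H_w ≤ g - p ⬝ a p`:
`-a : H_v ≤ η g + (q ⬝ a q)/η - w (a : H_η)`.
[cite: GilbargTrudinger2001, proof of Thm 9.22, first display (b = c = 0)] -/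
theorem neg_pair_hessian_product_le {a Hw Hη Hv : Matrix ι ι ℝ} (ha : a.IsSymm)
    (hpsd : ∀ v : ι → ℝ, 0 ≤ v ⬝ᵥ (a *ᵥ v)) {p q : ι → ℝ} {η w g : ℝ} (hη : 0 < η)
    (hHv : Hv = η • Hw + vecMulVec p q + vecMulVec q p + w • Hη)
    (hw : -pair a Hw ≤ g - p ⬝ᵥ (a *ᵥ p)) :
    -pair a Hv ≤ η * g + (q ⬝ᵥ (a *ᵥ q)) / η - w * pair a Hη := by
  rw [hHv, pair_add, pair_add, pair_add, pair_smul, pair_smul, pair_vecMulVec, pair_vecMulVec,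
    dotProduct_mulVec_comm ha p q]
  have hs := two_mul_abs_bilin_le ha hpsd p q hη
  have hab : -(2 * (q ⬝ᵥ (a *ᵥ p))) ≤ η * (p ⬝ᵥ (a *ᵥ p)) + (q ⬝ᵥ (a *ᵥ q)) / η := by
    have := neg_abs_le (q ⬝ᵥ (a *ᵥ p)); linarith
  have hη' : η * -pair a Hw ≤ η * (g - p ⬝ᵥ (a *ᵥ p)) := mul_le_mul_of_nonneg_left hw hη.le
  nlinarith

/-! ### The cutoff `η = (1 - s)^β`, `s = |x|² < 1`

At a point with coordinates `x`, `s = x ⬝ x`, the gradient of `η` is `q = -2β(1-s)^{β-1} x` and its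
Hessian matrix is `H_η = 4β(β-1)(1-s)^{β-2} x xᵀ - 2β(1-s)^{β-1} I`. -/

/-- The trace of `a ≤ Λ` is at most `nΛ`. [folklore] -/
theorem trace_le_card_mul {a : Matrix ι ι ℝ} {Λ : ℝ}
    (hΛ : ∀ v : ι → ℝ, v ⬝ᵥ (a *ᵥ v) ≤ Λ * (v ⬝ᵥ v)) : a.trace ≤ Fintype.card ι * Λ := by
  have h : ∀ i, a i i ≤ Λ := fun i ↦ by
    have := hΛ (Pi.single i 1)
    simpa using this
  calc a.trace = ∑ i, a i i := rfl
    _ ≤ ∑ _k : ι, Λ := Finset.sum_le_sum fun i _ ↦ h i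
    _ = Fintype.card ι * Λ := by simp

omit [DecidableEq ι] in
/-- **The gradient term of the cutoff**: with `q = -2β(1-s)^{β-1} x` (`s = x ⬝ x < 1`, `β ≥ 2`)
and `a ≤ Λ`, `Λ ≥ 0`: `(q ⬝ a q)/(1-s)^β ≤ 4β²Λ`.
[cite: GilbargTrudinger2001, proof of Thm 9.22 (the term `4β²Λ`)] -/
theorem eta_gradient_term_le {a : Matrix ι ι ℝ} {Λ : ℝ} (hΛ0 : 0 ≤ Λ)
    (hΛ : ∀ v : ι → ℝ, v ⬝ᵥ (a *ᵥ v) ≤ Λ * (v ⬝ᵥ v)) (x : ι → ℝ) {β : ℕ} (hβ : 2 ≤ β)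
    (hs1 : x ⬝ᵥ x < 1) :
    ((-(2 * (β : ℝ) * (1 - x ⬝ᵥ x) ^ (β - 1))) • x) ⬝ᵥ
        (a *ᵥ ((-(2 * (β : ℝ) * (1 - x ⬝ᵥ x) ^ (β - 1))) • x)) / (1 - x ⬝ᵥ x) ^ β ≤
      4 * (β : ℝ) ^ 2 * Λ := by
  obtain ⟨m, rfl⟩ : ∃ m, β = m + 2 := ⟨β - 2, by omega⟩
  set s := x ⬝ᵥ x with hs
  have hs0 : 0 ≤ s := (Finset.sum_nonneg fun _ _ ↦ mul_self_nonneg _ : (0 : ℝ) ≤ x ⬝ᵥ x)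
  have h1s : 0 < 1 - s := by linarith
  have h1s1 : 1 - s ≤ 1 := by linarith
  set c := -(2 * ((m + 2 : ℕ) : ℝ) * (1 - s) ^ (m + 2 - 1)) with hc
  have hcc : (c • x) ⬝ᵥ (a *ᵥ (c • x)) = c ^ 2 * (x ⬝ᵥ (a *ᵥ x)) := by
    rw [mulVec_smul, dotProduct_smul, smul_dotProduct, smul_eq_mul, smul_eq_mul]; ring
  rw [hcc]
  have hxax : x ⬝ᵥ (a *ᵥ x) ≤ Λ * s := hΛ x
  have hc2 : c ^ 2 = 4 * ((m + 2 : ℕ) : ℝ) ^ 2 * (1 - s) ^ (2 * (m + 1)) := by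
    rw [hc, show m + 2 - 1 = m + 1 by omega]; ring
  have hpow : (0 : ℝ) < (1 - s) ^ (m + 2) := pow_pos h1s _
  rw [div_le_iff₀ hpow, hc2]
  have hm1 : (1 - s) ^ (2 * (m + 1)) = (1 - s) ^ m * (1 - s) ^ (m + 2) := by
    rw [← pow_add]; congr 1; ring
  rw [hm1]
  have hsm : (1 - s) ^ m ≤ 1 := pow_le_one₀ h1s.le h1s1
  have hβ0 : (0 : ℝ) ≤ 4 * ((m + 2 : ℕ) : ℝ) ^ 2 := by positivity
  -- `4β² (1-s)^m (1-s)^{m+2} (x a x) ≤ 4β² (1-s)^m (1-s)^{m+2} Λ s ≤ 4β² Λ (1-s)^{m+2}`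
  have step1 : 4 * ((m + 2 : ℕ) : ℝ) ^ 2 * ((1 - s) ^ m * (1 - s) ^ (m + 2)) * (x ⬝ᵥ (a *ᵥ x)) ≤
      4 * ((m + 2 : ℕ) : ℝ) ^ 2 * ((1 - s) ^ m * (1 - s) ^ (m + 2)) * (Λ * s) :=
    mul_le_mul_of_nonneg_left hxax (by positivity)
  have step2 : (1 - s) ^ m * s ≤ 1 := by nlinarith [pow_nonneg h1s.le m]
  nlinarith [mul_nonneg hβ0 (mul_nonneg hΛ0 hpow.le)]

/-- **The Hessian of the cutoff pairs non-negatively away from the centre**: with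
`H_η = 4β(β-1)(1-s)^{β-2} x xᵀ - 2β(1-s)^{β-1} I`, `λ ≤ a ≤ Λ` (`λ > 0`), `α² ≤ s < 1` and
`2(β-1)λα² ≥ nΛ`: `a : H_η ≥ 0`. [cite: GilbargTrudinger2001, proof of Thm 9.22
("we have a^{ij}D_{ij}η ≥ 0 for all |x| ≥ α")] -/
theorem eta_hessian_pair_nonneg {a : Matrix ι ι ℝ} {lam Λ : ℝ} (hlam0 : 0 < lam) (hΛ0 : 0 ≤ Λ)
    (hlam : ∀ v : ι → ℝ, lam * (v ⬝ᵥ v) ≤ v ⬝ᵥ (a *ᵥ v))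
    (hΛ : ∀ v : ι → ℝ, v ⬝ᵥ (a *ᵥ v) ≤ Λ * (v ⬝ᵥ v)) (x : ι → ℝ) {β : ℕ} (hβ : 2 ≤ β) {α : ℝ}
    (hαs : α ^ 2 ≤ x ⬝ᵥ x) (hs1 : x ⬝ᵥ x < 1)
    (hβl : Fintype.card ι * Λ ≤ 2 * ((β : ℝ) - 1) * lam * α ^ 2) :
    0 ≤ pair a ((4 * (β : ℝ) * ((β : ℝ) - 1) * (1 - x ⬝ᵥ x) ^ (β - 2)) • vecMulVec x x -
      (2 * (β : ℝ) * (1 - x ⬝ᵥ x) ^ (β - 1)) • (1 : Matrix ι ι ℝ)) := by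
  obtain ⟨m, rfl⟩ : ∃ m, β = m + 2 := ⟨β - 2, by omega⟩
  set s := x ⬝ᵥ x with hs
  have h1s : 0 < 1 - s := by linarith
  have hs0 : 0 ≤ s := (Finset.sum_nonneg fun _ _ ↦ mul_self_nonneg _ : (0 : ℝ) ≤ x ⬝ᵥ x)
  have h1s' : 1 - s ≤ 1 := by linarith
  rw [sub_eq_add_neg, ← neg_smul, pair_add, pair_smul, pair_smul, pair_vecMulVec, pair_one,
    show m + 2 - 2 = m by omega, show m + 2 - 1 = m + 1 by omega, pow_succ]
  set B : ℝ := ((m + 2 : ℕ) : ℝ) with hB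
  set P := x ⬝ᵥ (a *ᵥ x)
  set T := a.trace
  set u := (1 - s) ^ m with hu
  have hB1 : B - 1 = m + 1 := by rw [hB]; push_cast; ring
  have hB0 : 0 ≤ B := by rw [hB]; positivity
  have hBm : 0 ≤ B - 1 := by rw [hB1]; positivity
  have hu0 : 0 ≤ u := pow_nonneg h1s.le m
  have hP : lam * s ≤ P := hlam x
  have hT : T ≤ Fintype.card ι * Λ := trace_le_card_mul hΛ
  have hnΛ : 0 ≤ (Fintype.card ι : ℝ) * Λ := by positivity
  -- the two monotone replacements
  have c1 : 0 ≤ 4 * B * (B - 1) * u := by positivity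
  have c2 : 0 ≤ 2 * B * (u * (1 - s)) := by positivity
  have r1 : 4 * B * (B - 1) * u * (lam * s) ≤ 4 * B * (B - 1) * u * P :=
    mul_le_mul_of_nonneg_left hP c1
  have r2 : 2 * B * (u * (1 - s)) * T ≤ 2 * B * (u * (1 - s)) * (Fintype.card ι * Λ) :=
    mul_le_mul_of_nonneg_left hT c2
  -- the scalar inequality `2(B-1) lam s ≥ (1-s) nΛ`
  have k1 : 2 * (B - 1) * lam * α ^ 2 ≤ 2 * (B - 1) * lam * s :=
    mul_le_mul_of_nonneg_left hαs (by positivity)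
  have k2 : (1 - s) * (Fintype.card ι * Λ) ≤ Fintype.card ι * Λ := by nlinarith
  have k3 : (1 - s) * (Fintype.card ι * Λ) ≤ 2 * (B - 1) * lam * s := by linarith
  have k4 : 2 * B * u * ((1 - s) * (Fintype.card ι * Λ)) ≤ 2 * B * u * (2 * (B - 1) * lam * s) :=
    mul_le_mul_of_nonneg_left k3 (by positivity)
  nlinarith [r1, r2, k4]

/-- **Near the centre the cutoff Hessian is controlled by `v`**: for `s < α² < 1`, `w ≥ 0`,
`0 ≤ a ≤ Λ`: `-w (a : H_η) ≤ (2βnΛ/(1-α²)) · ((1-s)^β w)`.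
[cite: GilbargTrudinger2001, proof of Thm 9.22 (the term `v χ(B_α) sup(-a^{ij}D_{ij}η/η)`)] -/
theorem neg_w_eta_hessian_le {a : Matrix ι ι ℝ} {Λ : ℝ} (hΛ0 : 0 ≤ Λ)
    (hpsd : ∀ v : ι → ℝ, 0 ≤ v ⬝ᵥ (a *ᵥ v))
    (hΛ : ∀ v : ι → ℝ, v ⬝ᵥ (a *ᵥ v) ≤ Λ * (v ⬝ᵥ v)) (x : ι → ℝ) {β : ℕ} (hβ : 2 ≤ β) {α : ℝ}
    (hsα : x ⬝ᵥ x < α ^ 2) (hα1 : α ^ 2 < 1) {w : ℝ} (hw : 0 ≤ w) :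
    -w * pair a ((4 * (β : ℝ) * ((β : ℝ) - 1) * (1 - x ⬝ᵥ x) ^ (β - 2)) • vecMulVec x x -
        (2 * (β : ℝ) * (1 - x ⬝ᵥ x) ^ (β - 1)) • (1 : Matrix ι ι ℝ)) ≤
      (2 * (β : ℝ) * (Fintype.card ι * Λ) / (1 - α ^ 2)) * ((1 - x ⬝ᵥ x) ^ β * w) := by
  obtain ⟨m, rfl⟩ : ∃ m, β = m + 2 := ⟨β - 2, by omega⟩
  set s := x ⬝ᵥ x with hs
  have h1s : 0 < 1 - s := by linarith
  have h1α : 0 < 1 - α ^ 2 := by linarith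
  rw [sub_eq_add_neg, ← neg_smul, pair_add, pair_smul, pair_smul, pair_vecMulVec, pair_one,
    show m + 2 - 2 = m by omega, show m + 2 - 1 = m + 1 by omega]
  set B : ℝ := ((m + 2 : ℕ) : ℝ) with hB
  set P := x ⬝ᵥ (a *ᵥ x)
  set T := a.trace
  have hB1 : B - 1 = m + 1 := by rw [hB]; push_cast; ring
  have hB0 : 0 ≤ B := by rw [hB]; positivity
  have hBm : 0 ≤ B - 1 := by rw [hB1]; positivity
  have hP : 0 ≤ P := hpsd x
  have hT : T ≤ Fintype.card ι * Λ := trace_le_card_mul hΛ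
  have hnΛ : 0 ≤ (Fintype.card ι : ℝ) * Λ := by positivity
  have hum : 0 ≤ (1 - s) ^ m := pow_nonneg h1s.le m
  have hum1 : 0 ≤ (1 - s) ^ (m + 1) := pow_nonneg h1s.le _
  -- `-w · pair ≤ w · 2B (1-s)^{m+1} T⁺ ≤ w 2B (1-s)^{m+1} nΛ`
  have step1 : -w * (4 * B * (B - 1) * (1 - s) ^ m * P + -(2 * B * (1 - s) ^ (m + 1)) * T) ≤
      w * (2 * B * (1 - s) ^ (m + 1) * (Fintype.card ι * Λ)) := by
    have e1 : 0 ≤ w * (4 * B * (B - 1) * (1 - s) ^ m * P) := by positivity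
    have e2 : w * (2 * B * (1 - s) ^ (m + 1) * T) ≤ w * (2 * B * (1 - s) ^ (m + 1) * (Fintype.card ι * Λ)) :=
      mul_le_mul_of_nonneg_left (mul_le_mul_of_nonneg_left hT (by positivity)) hw
    nlinarith
  refine step1.trans ?_
  -- `w 2B (1-s)^{m+1} nΛ = [2BnΛ/(1-s)] (1-s)^{m+2} w ≤ [2BnΛ/(1-α²)] (1-s)^{m+2} w`
  have e3 : w * (2 * B * (1 - s) ^ (m + 1) * (Fintype.card ι * Λ)) =
      (2 * B * (Fintype.card ι * Λ) / (1 - s)) * ((1 - s) ^ (m + 2) * w) := by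
    field_simp; ring
  rw [e3]
  have hfrac : 2 * B * (Fintype.card ι * Λ) / (1 - s) ≤ 2 * B * (Fintype.card ι * Λ) / (1 - α ^ 2) :=
    div_le_div_of_nonneg_left (by positivity) h1α (by linarith)
  exact mul_le_mul_of_nonneg_right hfrac (by positivity)

/-- **The pointwise right-hand side of the barrier inequality** (GT p. 247, `b = c = 0`): at a
point of `{v > 0}` (`v = ηw`, `η = (1-s)^β > 0`, so `w > 0`), with `λ ≤ a ≤ Λ` symmetric,
`2(β-1)λα² ≥ nΛ`, `α² < 1`, `β ≥ 2`, and `-a:H_v ≤ ηg + (q⬝aq)/η - w a:H_η` already established: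
`-a : H_v ≤ 4β²Λ + g⁺ + (2βnΛ/(1-α²)) v 𝟙_{s < α²}`.
[cite: GilbargTrudinger2001, proof of Thm 9.22, third display] -/
theorem barrier_rhs_le {a Hv : Matrix ι ι ℝ} {lam Λ : ℝ} (hlam0 : 0 < lam) (hΛ0 : 0 ≤ Λ)
    (hlam : ∀ v : ι → ℝ, lam * (v ⬝ᵥ v) ≤ v ⬝ᵥ (a *ᵥ v))
    (hΛ : ∀ v : ι → ℝ, v ⬝ᵥ (a *ᵥ v) ≤ Λ * (v ⬝ᵥ v)) (x : ι → ℝ) {β : ℕ} (hβ : 2 ≤ β) {α : ℝ}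
    (hα1 : α ^ 2 < 1) (hs1 : x ⬝ᵥ x < 1)
    (hβl : Fintype.card ι * Λ ≤ 2 * ((β : ℝ) - 1) * lam * α ^ 2) {w g : ℝ} (hw : 0 < w)
    (hv : -pair a Hv ≤ (1 - x ⬝ᵥ x) ^ β * g +
      (((-(2 * (β : ℝ) * (1 - x ⬝ᵥ x) ^ (β - 1))) • x) ⬝ᵥ
        (a *ᵥ ((-(2 * (β : ℝ) * (1 - x ⬝ᵥ x) ^ (β - 1))) • x))) / (1 - x ⬝ᵥ x) ^ β -
      w * pair a ((4 * (β : ℝ) * ((β : ℝ) - 1) * (1 - x ⬝ᵥ x) ^ (β - 2)) • vecMulVec x x -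
        (2 * (β : ℝ) * (1 - x ⬝ᵥ x) ^ (β - 1)) • (1 : Matrix ι ι ℝ))) :
    -pair a Hv ≤ 4 * (β : ℝ) ^ 2 * Λ + max g 0 +
      (if x ⬝ᵥ x < α ^ 2 then (2 * (β : ℝ) * (Fintype.card ι * Λ) / (1 - α ^ 2)) *
        ((1 - x ⬝ᵥ x) ^ β * w) else 0) := by
  set s := x ⬝ᵥ x with hs
  have h1s : 0 < 1 - s := by linarith
  have hs0 : 0 ≤ s := (Finset.sum_nonneg fun _ _ ↦ mul_self_nonneg _ : (0 : ℝ) ≤ x ⬝ᵥ x)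
  have hη1 : (1 - s) ^ β ≤ 1 := pow_le_one₀ h1s.le (by linarith)
  have hη0 : 0 < (1 - s) ^ β := pow_pos h1s β
  have hpsd : ∀ v : ι → ℝ, 0 ≤ v ⬝ᵥ (a *ᵥ v) := fun v ↦
    (mul_nonneg hlam0.le ((Finset.sum_nonneg fun _ _ ↦ mul_self_nonneg _ : (0 : ℝ) ≤ v ⬝ᵥ v))).trans (hlam v)
  have t1 : (1 - s) ^ β * g ≤ max g 0 := by
    rcases le_or_gt 0 g with hg | hg
    · rw [max_eq_left hg]; nlinarith
    · rw [max_eq_right hg.le]; nlinarith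
  have t2 := eta_gradient_term_le hΛ0 hΛ x hβ hs1
  refine hv.trans ?_
  split_ifs with hcase
  · have t3 := neg_w_eta_hessian_le hΛ0 hpsd hΛ x hβ hcase hα1 hw.le
    nlinarith [t1, t2, t3]
  · push Not at hcase
    have t3 := eta_hessian_pair_nonneg hlam0 hΛ0 hlam hΛ x hβ hcase hs1 hβl
    nlinarith [t1, t2, t3, mul_nonneg hw.le t3]

end Literature.Analysis.PDE.KrylovSafonov

end
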